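import Literature.NumberTheory.Sieve.GoldbachVerificationCertificates
import Literature.NumberTheory.Sieve.CircleMethod
import HarnessLib

/-!
# Ternary Goldbach (parity.S11): Helfgott's top-level assembly, proved

Topic `Literature/NumberTheory/Sieve`; sibling proof file of `ParityWave0.lean` for the named fact
`Literature.NumberTheory.Sieve.exists_prime_add_prime_add_prime_eq_of_odd` — H. A. Helfgott, *The
ternary Goldbach conjecture is true*, arXiv:1312.7748 (2013), Main Theorem (§1.1): *every odd integer
`n` greater than `5` can be expressed as the sum of three primes*. Everything in this file is PROVED
(theorems only: no definitions, no new named facts). The fact itself is NOT discharged here (its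
docstring in `ParityWave0.lean` records why no `_holds` is expected: a book-length body of explicit
circle-method estimates for `n ≥ 10²⁷` plus certified computations below); what is proved is the
printed reduction of the Main Theorem to its three inputs, so that the fact's trust base is spelled
out in Lean and each input can be fed in separately.

**The printed architecture** (materialised text `paper:arxiv-1312.7748`). §1.1, after the Main
Theorem: "The proof given here works for all `n ≥ C = 10²⁷`. … Verifying the main theorem for
`n < 10²⁷` is really a minor computational task; it was already done for all `n ≤ 8.875·10³⁰` in
[HelPlat]." §1.2.2: "Oliveira e Silva, Herzog and Pardi [OSHP] have proven that every even integer
`4 ≤ n ≤ 4·10¹⁸` is the sum of two primes. Clearly, if one can show that every interval of length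
`≥ 4·10¹⁸ − 4` within `[1, N]` contains a prime, then [OSHP] implies that every odd number between `7`
and `N` can be written as the sum of three primes … Alternatively, one can simply construct a
sequence of primes up to `N` such that any two consecutive primes in the list differ by at most
`4·10¹⁸ − 4`. This was done in [HelPlat] for `N = 8.875694·10³⁰`." Final appendix (*Checking small
`n` by checking zeros of `ζ(s)`*), opening paragraph: "In order to show that every odd number
`n ≤ N` is the sum of three primes, it is enough to show for some `M ≤ N` that (1) every even integer
`4 ≤ m ≤ M` can be written as the sum of two primes, (2) the difference between any two consecutive
primes `≤ N` is at most `M − 4`." §7.4 (conclusion): "this shows that every odd number `N ≥ 10²⁷`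
can be written as the sum of three odd primes. Since the ternary Goldbach conjecture has already
been checked for all `N ≤ 8.875·10³⁰` [HelPlat], we conclude that … every odd number `N > 5` can be
written as the sum of three primes."

**What this file proves.**
* `exists_three_primes_of_goldbachUpTo` — the appendix reduction in the interval form of §1.2.2:
  `GoldbachUpTo M` (the tree's bounded-Goldbach predicate, `GoldbachVerification.lean`) and a prime
  in every `[k − M, k − 4]`, `M + 4 ≤ k ≤ N`, give three primes summing to every odd `7 ≤ n ≤ N`
  (for `n ≤ M + 3` the first hypothesis alone: `n = 3 + (n − 3)`).
* `exists_prime_add_four_le_of_ladder` — the appendix's condition (2) / the [HelPlat] ladder implies the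
  interval hypothesis: a finite list of primes starting `≤ M`, with consecutive gaps `≤ M − 4`,
  reaching past `N − 4`.
* `exists_three_primes_of_goldbachUpTo_of_ladder` — the two combined (the appendix reduction as
  printed, with the ladder's end made explicit: it must reach past `N − 4`, a boundary condition the
  printed sentence leaves implicit).
* `exists_three_primes_of_odd_le` — UNCONDITIONAL, kernel-checked initial segment of the fact:
  every odd `5 < n ≤ 10⁸ + 3` is a sum of three primes, from `goldbachUpTo_ten_pow_eight`
  (`GoldbachVerificationCertificates.lean`, Stein–Stein's 1965 range re-verified in the kernel).
* `exists_prime_add_prime_add_prime_eq_of_odd_of_le_of_lt` — the §7.4 case split: the statement for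
  odd `n ≥ C` and for odd `5 < n < C` give the fact.
* `exists_prime_add_prime_add_prime_eq_of_odd_of_goldbach_of_le` and `…_of_ladder` — the Main
  Theorem from exactly Helfgott's three inputs: the analytic theorem for odd `N ≥ 10²⁷` (hypothesis),
  the tree's named fact `goldbach_of_le` ([OSHP], parity.S16, hypothesis `(hG : goldbach_of_le)`),
  and primes in all intervals `[k − 4·10¹⁸, k − 4]`, `k < 10²⁷` (resp. a [HelPlat]-type ladder).
* `exists_prime_add_prime_add_prime_eq_of_odd.sum_primes_le_four` — Corollary 1.1 of the paper
  (every integer `n > 1` is the sum of at most four primes), conditional on the fact.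
* `weightedTernaryCount_sub_sum_filter_prime_le`, `exists_three_primes_of_lt_weightedTernaryCount`
  (and the explicit `…'` via Mathlib's Chebyshev bounds) — the concluding step of §7.4 (and of
  Vinogradov's theorem, Vaughan Thm. 3.4 ⇒ Corollary) for the tree's `Λ`-weighted count
  `weightedTernaryCount N = ∑_{n₁+n₂+n₃=N} Λ(n₁)Λ(n₂)Λ(n₃)` (`CircleMethod.lean`): the triples with a
  non-prime entry contribute at most `3 (ψ(N) − ϑ(N)) ψ(N) log N ≤ 6 (log 4 + 4) N^{3/2} (log N)²`,
  so any larger lower bound for `R₃(N)` yields three primes summing to `N`. This is the interface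
  through which an (in)effective three-primes theorem for large `N` would feed `hlarge` above.

## References
* H. A. Helfgott, *The ternary Goldbach conjecture is true*, arXiv:1312.7748 (2013): Main Theorem
  and Corollary 1.1 (§1.1–1.2), §1.2.2, §7.4, final appendix. [Helfgott2013TernaryGoldbach]
* H. A. Helfgott, D. J. Platt, *Numerical verification of the ternary Goldbach conjecture up to
  8.875·10³⁰*, Exp. Math. 22 (2013) 406–409. [HelfgottPlatt2013]
* T. Oliveira e Silva, S. Herzog, S. Pardi, Math. Comp. 83 (2014) 2033–2060 (binary Goldbach to
  `4·10¹⁸`; the tree's `goldbach_of_le`). [OliveiraSilvaHerzogPardi2014]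
* M. L. Stein, P. R. Stein, Math. Comp. 19 (1965), p. 433 (Goldbach to `10⁸`; the tree's
  `goldbachUpTo_ten_pow_eight`). [SteinStein1965]
* R. C. Vaughan, *The Hardy–Littlewood Method*, 2nd ed. (CUP 1997), §3.1, Theorem 3.4 and its
  Corollary (the `Λ`/`log`-weighted count and the passage to three primes). [VaughanHL1997]
-/

namespace Literature.NumberTheory.Sieve

/-! ### The reduction to bounded binary Goldbach and prime gaps -/

/-- **Helfgott 2013, final appendix (opening reduction), interval form of §1.2.2.** If every even
`4 ≤ m ≤ M` is a sum of two primes and every interval `[k − M, k − 4]` with `M + 4 ≤ k ≤ N` contains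
a prime, then every odd `7 ≤ n ≤ N` is a sum of three primes. (For `n ≤ M + 3`: `n − 3` is even with
`4 ≤ n − 3 ≤ M`. For `n ≥ M + 4`: a prime `p ∈ [n − M, n − 4]` is `≥ 4`, hence odd, so `n − p` is
even with `4 ≤ n − p ≤ M`.) [cite: Helfgott2013TernaryGoldbach, §1.2.2 and final appendix (opening reduction)] -/
theorem exists_three_primes_of_goldbachUpTo {M N : ℕ} (hG : GoldbachUpTo M)
    (hI : ∀ k : ℕ, M + 4 ≤ k → k ≤ N → ∃ p : ℕ, p.Prime ∧ p + 4 ≤ k ∧ k ≤ p + M)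
    {n : ℕ} (hn : Odd n) (h7 : 7 ≤ n) (hN : n ≤ N) :
    ∃ p q r : ℕ, p.Prime ∧ q.Prime ∧ r.Prime ∧ p + q + r = n := by
  rcases le_or_gt n (M + 3) with hle | hlt
  · -- `n = 3 + (n - 3)` with `n - 3` even, `4 ≤ n - 3 ≤ M`
    obtain ⟨m, rfl⟩ : ∃ m, n = m + 3 := ⟨n - 3, by omega⟩
    have hm : Even m := (Nat.odd_add'.mp hn).mp (by decide)
    obtain ⟨p, q, hp, hq, hpq⟩ := hG m hm (by omega) (by omega)
    exact ⟨p, q, 3, hp, hq, Nat.prime_three, by omega⟩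
  · -- a prime `p ∈ [n - M, n - 4]`; `p ≥ 4` is odd, `n - p` is even, `4 ≤ n - p ≤ M`
    obtain ⟨p, hp, hp4, hpM⟩ := hI n (by omega) hN
    have hpodd : Odd p := hp.odd_of_ne_two (by omega)
    obtain ⟨m, rfl⟩ : ∃ m, n = m + p := ⟨n - p, by omega⟩
    have hm : Even m := (Nat.odd_add'.mp hn).mp hpodd
    obtain ⟨q, r, hq, hr, hqr⟩ := hG m hm (by omega) (by omega)
    exact ⟨p, q, r, hp, hq, hr, by omega⟩

/-- **From a ladder of primes to primes in all intervals** (Helfgott 2013, final appendix,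
condition (2): "the difference between any two consecutive primes `≤ N` is at most `M − 4`"; §1.2.2:
"a sequence of primes up to `N` such that any two consecutive primes in the list differ by at most
`4·10¹⁸ − 4`"; the "ladder" of Saouter and Helfgott–Platt, Exp. Math. 22 (2013), §1). If `P 0, …, P k`
are primes with `P 0 ≤ M`, consecutive gaps `P (i+1) − P i ≤ M − 4` and `P k ≥ N − 3`, then every
interval `[n − M, n − 4]` with `M + 4 ≤ n ≤ N` contains one of them (the last rung `≤ n − 4`).
Monotonicity of the ladder is not needed. [cite: Helfgott2013TernaryGoldbach, final appendix condition (2) and §1.2.2] -/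
theorem exists_prime_add_four_le_of_ladder {M N k : ℕ} (P : ℕ → ℕ) (hprime : ∀ i ≤ k, (P i).Prime)
    (h0 : P 0 ≤ M) (hstep : ∀ i < k, P (i + 1) + 4 ≤ P i + M) (hk : N ≤ P k + 3) :
    ∀ n : ℕ, M + 4 ≤ n → n ≤ N → ∃ p : ℕ, p.Prime ∧ p + 4 ≤ n ∧ n ≤ p + M := by
  intro n hMn hnN
  -- the last rung `≤ n - 4`
  set i := Nat.findGreatest (fun j => P j + 4 ≤ n) k
  have hi0 : P 0 + 4 ≤ n := by omega
  have hile : i ≤ k := Nat.findGreatest_le k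
  have hiP : P i + 4 ≤ n := Nat.findGreatest_spec (P := fun j => P j + 4 ≤ n) (Nat.zero_le k) hi0
  have hik : i < k := by
    rcases lt_or_eq_of_le hile with h | h
    · exact h
    · exfalso; rw [h] at hiP; omega
  -- the next rung is `> n - 4`, and at most `M - 4` further
  have hnext : ¬ (P (i + 1) + 4 ≤ n) :=
    Nat.findGreatest_is_greatest (P := fun j => P j + 4 ≤ n) (Nat.lt_succ_self i) hik
  exact ⟨P i, hprime i hile, hiP, by have := hstep i hik; omega⟩

/-- **Helfgott 2013, final appendix, opening reduction (as printed, ladder form).** "In order to show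
that every odd number `n ≤ N` is the sum of three primes, it is enough to show for some `M ≤ N` that
(1) every even integer `4 ≤ m ≤ M` can be written as the sum of two primes, (2) the difference
between any two consecutive primes `≤ N` is at most `M − 4`" — here with (2) as an explicit finite
ladder of primes `P 0 ≤ M`, gaps `≤ M − 4`, reaching `P k ≥ N − 3` (the boundary condition the
printed sentence leaves implicit), and "odd `n`" meaning `7 ≤ n` (no odd `n ≤ 5` is a sum of three
primes). [cite: Helfgott2013TernaryGoldbach, final appendix (opening reduction)] -/
theorem exists_three_primes_of_goldbachUpTo_of_ladder {M N k : ℕ} (hG : GoldbachUpTo M)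
    (P : ℕ → ℕ) (hprime : ∀ i ≤ k, (P i).Prime) (h0 : P 0 ≤ M)
    (hstep : ∀ i < k, P (i + 1) + 4 ≤ P i + M) (hk : N ≤ P k + 3)
    {n : ℕ} (hn : Odd n) (h7 : 7 ≤ n) (hN : n ≤ N) :
    ∃ p q r : ℕ, p.Prime ∧ q.Prime ∧ r.Prime ∧ p + q + r = n :=
  exists_three_primes_of_goldbachUpTo hG (exists_prime_add_four_le_of_ladder P hprime h0 hstep hk)
    hn h7 hN

/-- **Ternary Goldbach up to `10⁸ + 3`, unconditionally and inside the kernel** (the named fact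
`exists_prime_add_prime_add_prime_eq_of_odd` restricted to `n ≤ 10⁸ + 3`): every odd
`5 < n ≤ 10⁸ + 3` is a sum of three primes — from the kernel-checked binary verification
`goldbachUpTo_ten_pow_eight` (Stein–Stein's 1965 range) by `n = 3 + (n − 3)`; no prime-gap input is
needed below `M + 4`. (Helfgott's proof uses the same step with `M = 4·10¹⁸` from [OSHP].)
[cite: Helfgott2013TernaryGoldbach, §1.2.2] -/
theorem exists_three_primes_of_odd_le {n : ℕ} (hn : Odd n) (h5 : 5 < n) (hle : n ≤ 10 ^ 8 + 3) :
    ∃ p q r : ℕ, p.Prime ∧ q.Prime ∧ r.Prime ∧ p + q + r = n :=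
  exists_three_primes_of_goldbachUpTo (N := 10 ^ 8 + 3) goldbachUpTo_ten_pow_eight
    (fun k hk hkN => absurd (hk.trans hkN) (by norm_num)) hn
    (by obtain ⟨m, rfl⟩ := hn; omega) hle

/-! ### Assembly of the Main Theorem from its printed inputs -/

/-- **Helfgott 2013, §7.4 (the final case split).** The ternary Goldbach statement for all odd
`n ≥ C` ("the proof given here works for all `n ≥ C = 10²⁷`") together with its verification for
odd `5 < n < C` gives the Main Theorem. [cite: Helfgott2013TernaryGoldbach, §1.1 and §7.4] -/
theorem exists_prime_add_prime_add_prime_eq_of_odd_of_le_of_lt {C : ℕ}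
    (hlarge : ∀ n : ℕ, Odd n → C ≤ n → ∃ p q r : ℕ, p.Prime ∧ q.Prime ∧ r.Prime ∧ p + q + r = n)
    (hsmall : ∀ n : ℕ, Odd n → 5 < n → n < C →
      ∃ p q r : ℕ, p.Prime ∧ q.Prime ∧ r.Prime ∧ p + q + r = n) :
    exists_prime_add_prime_add_prime_eq_of_odd :=
  fun n hn h5 => (lt_or_ge n C).elim (hsmall n hn h5) (hlarge n hn)

/-- **Helfgott's Main Theorem from its three printed inputs** (§1.1, §1.2.2, §7.4): (i) the analytic
theorem for odd `N ≥ 10²⁷` (§7.4: "every odd number `N ≥ 10²⁷` can be written as the sum of three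
odd primes"; hypothesis `hlarge`, the book-length part), (ii) binary Goldbach for even
`4 ≤ m ≤ 4·10¹⁸` (Oliveira e Silva–Herzog–Pardi; the tree's named fact `goldbach_of_le`,
parity.S16, hypothesis `hG`), (iii) a prime in every interval `[k − 4·10¹⁸, k − 4]`,
`4·10¹⁸ + 4 ≤ k < 10²⁷` (§1.2.2; [HelPlat], or the appendix's Proposition via Platt's verification of
the first `1.1·10¹¹` zeros of `ζ`; hypothesis `hI`). [cite: Helfgott2013TernaryGoldbach, §§1.1–1.2.2 and §7.4] -/
theorem exists_prime_add_prime_add_prime_eq_of_odd_of_goldbach_of_le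
    (hlarge : ∀ n : ℕ, Odd n → 10 ^ 27 ≤ n →
      ∃ p q r : ℕ, p.Prime ∧ q.Prime ∧ r.Prime ∧ p + q + r = n)
    (hG : goldbach_of_le)
    (hI : ∀ k : ℕ, 4 * 10 ^ 18 + 4 ≤ k → k < 10 ^ 27 →
      ∃ p : ℕ, p.Prime ∧ p + 4 ≤ k ∧ k ≤ p + 4 * 10 ^ 18) :
    exists_prime_add_prime_add_prime_eq_of_odd := by
  refine exists_prime_add_prime_add_prime_eq_of_odd_of_le_of_lt hlarge fun n hn h5 hC => ?_
  have h7 : 7 ≤ n := by obtain ⟨m, rfl⟩ := hn; omega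
  have hG' : GoldbachUpTo (4 * 10 ^ 18) := hG
  exact exists_three_primes_of_goldbachUpTo (N := n) hG'
    (fun k hk hkn => hI k hk (lt_of_le_of_lt hkn hC)) hn h7 le_rfl

/-- **Helfgott's Main Theorem from the analytic part, [OSHP] and a [HelPlat]-type ladder**: the
analytic theorem for odd `N ≥ 10²⁷`, the tree's `goldbach_of_le`, and any finite list of primes
`P 0 ≤ 4·10¹⁸`, consecutive gaps `≤ 4·10¹⁸ − 4`, last rung `≥ 10²⁷ − 4` (§1.2.2: "The task of
constructing the sequence of primes up to `10²⁷` — enough to complete the proof of the main theorem —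
takes only about 25 hours on a single processor core") give the fact.
[cite: Helfgott2013TernaryGoldbach, §1.2.2 and §7.4] -/
theorem exists_prime_add_prime_add_prime_eq_of_odd_of_ladder
    (hlarge : ∀ n : ℕ, Odd n → 10 ^ 27 ≤ n →
      ∃ p q r : ℕ, p.Prime ∧ q.Prime ∧ r.Prime ∧ p + q + r = n)
    (hG : goldbach_of_le) {k : ℕ} (P : ℕ → ℕ) (hprime : ∀ i ≤ k, (P i).Prime)
    (h0 : P 0 ≤ 4 * 10 ^ 18) (hstep : ∀ i < k, P (i + 1) + 4 ≤ P i + 4 * 10 ^ 18)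
    (hk : 10 ^ 27 ≤ P k + 4) :
    exists_prime_add_prime_add_prime_eq_of_odd :=
  exists_prime_add_prime_add_prime_eq_of_odd_of_goldbach_of_le hlarge hG fun n hMn hnC =>
    exists_prime_add_four_le_of_ladder (N := 10 ^ 27 - 1) P hprime h0 hstep (by omega) n hMn
      (by omega)

/-! ### Corollary 1.1: four primes -/

/-- **Helfgott 2013, Corollary 1.1 (to Main Theorem).** "Every integer `n > 1` is the sum of at most
`4` primes." Printed proof: "If `n` is odd and `> 5`, the main theorem applies. If `n` is even and
`> 8`, apply the main theorem to `n − 3`. Do the cases `n ≤ 8` separately." Conditional on the named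
fact, as a list of at most four primes summing to `n`. [cite: Helfgott2013TernaryGoldbach, Corollary 1.1] -/
theorem exists_prime_add_prime_add_prime_eq_of_odd.sum_primes_le_four
    (h : exists_prime_add_prime_add_prime_eq_of_odd) {n : ℕ} (hn : 1 < n) :
    ∃ l : List ℕ, l.length ≤ 4 ∧ (∀ p ∈ l, p.Prime) ∧ l.sum = n := by
  rcases le_or_gt n 8 with h8 | h8
  · -- `2, 3, 2+2, 5, 3+3, 7, 3+5`
    interval_cases n
    · exact ⟨[2], by simp, by simp [Nat.prime_two], rfl⟩
    · exact ⟨[3], by simp, by simp [Nat.prime_three], rfl⟩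
    · exact ⟨[2, 2], by simp, by simp [Nat.prime_two], rfl⟩
    · exact ⟨[5], by simp, by simp [Nat.prime_five], rfl⟩
    · exact ⟨[3, 3], by simp, by simp [Nat.prime_three], rfl⟩
    · exact ⟨[7], by simp, by simp; norm_num, rfl⟩
    · exact ⟨[3, 5], by simp, by simp [Nat.prime_three, Nat.prime_five], rfl⟩
  · rcases Nat.even_or_odd n with he | ho
    · -- `n` even, `n > 8`: `n - 3` is odd and `> 5`
      obtain ⟨m, rfl⟩ : ∃ m, n = m + 3 := ⟨n - 3, by omega⟩
      have hm : Odd m := by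
        rcases Nat.even_or_odd m with hm | hm
        · exact absurd he (Nat.not_even_iff_odd.mpr (hm.add_odd (by decide)))
        · exact hm
      obtain ⟨p, q, r, hp, hq, hr, hpqr⟩ := h m hm (by omega)
      exact ⟨[p, q, r, 3], by simp, by simp [hp, hq, hr, Nat.prime_three], by simp; omega⟩
    · obtain ⟨p, q, r, hp, hq, hr, hpqr⟩ := h n ho (by omega)
      exact ⟨[p, q, r], by simp, by simp [hp, hq, hr], by simp; omega⟩

/-! ### The step from the `Λ`-weighted count to three primes (§7.4) -/

section PrimePowers

open scoped Chebyshev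
open Finset ArithmeticFunction

/-- Each coordinate of a tuple in `antidiagonalTuple k N` is `≤ N`. [folklore] -/
private theorem apply_le_of_mem_antidiagonalTuple {k N : ℕ} {n : Fin k → ℕ}
    (hn : n ∈ Finset.Nat.antidiagonalTuple k N) (i : Fin k) : n i ≤ N := by
  rw [Finset.Nat.mem_antidiagonalTuple] at hn
  rw [← hn]
  exact Finset.single_le_sum (fun j _ => Nat.zero_le (n j)) (Finset.mem_univ i)

/-- `Λ(m) ≤ log N` for `m ≤ N`. [folklore] -/
private theorem vonMangoldt_le_log_of_le {m N : ℕ} (h : m ≤ N) : Λ m ≤ Real.log N := by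
  rcases Nat.eq_zero_or_pos m with rfl | hm
  · rw [ArithmeticFunction.map_zero]; exact Real.log_natCast_nonneg N
  · exact vonMangoldt_le_log.trans (Real.log_le_log (by exact_mod_cast hm) (by exact_mod_cast h))

/-- The sum of `∏ⱼ Λ(nⱼ)` over the triples `n₁ + n₂ + n₃ = N` whose `i`-th entry is not prime does
not depend on `i` (permute the coordinates). [folklore] -/
private theorem sum_filter_not_prime_apply_eq (N : ℕ) (i : Fin 3) :
    ∑ n ∈ (Finset.Nat.antidiagonalTuple 3 N).filter (fun n => ¬ (n i).Prime), ∏ j, Λ (n j) =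
      ∑ n ∈ (Finset.Nat.antidiagonalTuple 3 N).filter (fun n => ¬ (n 0).Prime), ∏ j, Λ (n j) := by
  refine Finset.sum_equiv ((Equiv.swap (0 : Fin 3) i).arrowCongr (Equiv.refl ℕ)) (fun n => ?_)
    (fun n _ => ?_)
  · simp only [Finset.mem_filter, Finset.Nat.mem_antidiagonalTuple, Equiv.arrowCongr_apply,
      Equiv.coe_refl, Equiv.symm_swap, Function.comp_apply, id_eq, Equiv.swap_apply_left]
    rw [Equiv.sum_comp (Equiv.swap (0 : Fin 3) i) n]
  · simp only [Equiv.arrowCongr_apply, Equiv.coe_refl, Equiv.symm_swap, Function.comp_apply, id_eq]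
    exact (Equiv.prod_comp (Equiv.swap (0 : Fin 3) i) (fun j => Λ (n j))).symm

/-- The triples with first entry a non-prime contribute at most `(ψ(N) − ϑ(N)) ψ(N) log N`:
bound `Λ(n₃) ≤ log N` and inject `n ↦ (n₁, n₂)` into `{m ≤ N non-prime} × {m ≤ N}`
(Helfgott 2013, §7.4, display after "Clearly"). [cite: Helfgott2013TernaryGoldbach, §7.4] -/
private theorem sum_filter_not_prime_zero_le (N : ℕ) :
    ∑ n ∈ (Finset.Nat.antidiagonalTuple 3 N).filter (fun n => ¬ (n 0).Prime), ∏ j, Λ (n j) ≤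
      (ψ N - θ N) * ψ N * Real.log N := by
  set S := (Finset.Nat.antidiagonalTuple 3 N).filter (fun n => ¬ (n 0).Prime) with hS
  have hA : ∑ a ∈ (Icc 0 N).filter (fun a => ¬ a.Prime), Λ a = ψ N - θ N := by
    rw [Chebyshev.psi_sub_theta_eq_sum_not_prime, Nat.floor_natCast, Finset.sum_filter,
      Finset.sum_filter, ← Finset.add_sum_Ioc_eq_sum_Icc (Nat.zero_le N)]
    simp
  have hB : ∑ b ∈ Icc 0 N, Λ b = ψ N := by
    rw [Chebyshev.psi_eq_sum_Icc, Nat.floor_natCast]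
  -- pointwise `Λ(n₁) Λ(n₂) Λ(n₃) ≤ Λ(n₁) Λ(n₂) log N`
  have h1 : ∀ n ∈ S, ∏ j, Λ (n j) ≤ Λ (n 0) * Λ (n 1) * Real.log N := by
    intro n hn
    rw [Fin.prod_univ_three]
    exact mul_le_mul_of_nonneg_left
      (vonMangoldt_le_log_of_le (apply_le_of_mem_antidiagonalTuple (Finset.mem_filter.mp hn).1 2))
      (mul_nonneg vonMangoldt_nonneg vonMangoldt_nonneg)
  -- `n ↦ (n₁, n₂)` is injective on the triples with `n₁ + n₂ + n₃ = N`
  have hinj : Set.InjOn (fun n : Fin 3 → ℕ => (n 0, n 1)) ↑S := by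
    intro n hn n' hn' h
    simp only [hS, Finset.coe_filter, Set.mem_setOf_eq, Finset.Nat.mem_antidiagonalTuple,
      Fin.sum_univ_three] at hn hn'
    simp only [Prod.mk.injEq] at h
    funext j
    fin_cases j
    · exact h.1
    · exact h.2
    · simp only [Fin.reduceFinMk]
      omega
  have hsub : S.image (fun n : Fin 3 → ℕ => (n 0, n 1)) ⊆
      (Icc 0 N).filter (fun a => ¬ a.Prime) ×ˢ Icc 0 N := by
    intro ab hab
    obtain ⟨n, hn, rfl⟩ := Finset.mem_image.mp hab
    have hT := (Finset.mem_filter.mp hn).1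
    simp only [Finset.mem_product, Finset.mem_filter, Finset.mem_Icc, Nat.zero_le, true_and]
    exact ⟨⟨apply_le_of_mem_antidiagonalTuple hT 0, (Finset.mem_filter.mp hn).2⟩,
      apply_le_of_mem_antidiagonalTuple hT 1⟩
  calc ∑ n ∈ S, ∏ j, Λ (n j)
      ≤ ∑ n ∈ S, Λ (n 0) * Λ (n 1) * Real.log N := Finset.sum_le_sum h1
    _ = ∑ ab ∈ S.image (fun n : Fin 3 → ℕ => (n 0, n 1)), Λ ab.1 * Λ ab.2 * Real.log N :=
        (Finset.sum_image (f := fun ab : ℕ × ℕ => Λ ab.1 * Λ ab.2 * Real.log N) hinj).symm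
    _ ≤ ∑ ab ∈ (Icc 0 N).filter (fun a => ¬ a.Prime) ×ˢ Icc 0 N, Λ ab.1 * Λ ab.2 * Real.log N :=
        Finset.sum_le_sum_of_subset_of_nonneg hsub fun ab _ _ =>
          mul_nonneg (mul_nonneg vonMangoldt_nonneg vonMangoldt_nonneg) (Real.log_natCast_nonneg N)
    _ = (∑ a ∈ (Icc 0 N).filter (fun a => ¬ a.Prime), Λ a) * (∑ b ∈ Icc 0 N, Λ b) * Real.log N := by
        rw [Finset.sum_product, Finset.sum_mul, Finset.sum_mul]
        refine Finset.sum_congr rfl fun a _ => ?_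
        rw [Finset.mul_sum, Finset.sum_mul]
    _ = (ψ N - θ N) * ψ N * Real.log N := by rw [hA, hB]

/-- **Helfgott 2013, §7.4: removing the prime powers** (with the trivial smoothing `η ≡ 1`; also
Vaughan, *The Hardy–Littlewood Method*, §3.1). The `Λ`-weighted ternary count
`R₃(N) = ∑_{n₁+n₂+n₃=N} Λ(n₁)Λ(n₂)Λ(n₃)` (the tree's `weightedTernaryCount`) exceeds its sub-sum over
triples of primes by at most `3 (ψ(N) − ϑ(N)) ψ(N) log N` ("the contribution of terms with `n₁`,
`n₂` or `n₃` non-prime … `≤ 3 … (log N) ∑_{n₁ ≤ N non-prime} Λ(n₁) ∑_{n₂ ≤ N} Λ(n₂)`").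
[cite: Helfgott2013TernaryGoldbach, §7.4] -/
theorem weightedTernaryCount_sub_sum_filter_prime_le (N : ℕ) :
    weightedTernaryCount N -
        ∑ n ∈ (Finset.Nat.antidiagonalTuple 3 N).filter (fun n => ∀ i, (n i).Prime), ∏ i, Λ (n i) ≤
      3 * ((ψ N - θ N) * ψ N * Real.log N) := by
  set T := Finset.Nat.antidiagonalTuple 3 N
  have hnn : ∀ n : Fin 3 → ℕ, 0 ≤ ∏ i, Λ (n i) :=
    fun n => Finset.prod_nonneg fun i _ => vonMangoldt_nonneg
  have hite : ∀ (n : Fin 3 → ℕ) (i : Fin 3), 0 ≤ (if ¬ (n i).Prime then ∏ j, Λ (n j) else 0) :=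
    fun n i => by split_ifs <;> first | exact le_rfl | exact hnn n
  rw [weightedTernaryCount, ← Finset.sum_filter_add_sum_filter_not T (fun n => ∀ i, (n i).Prime),
    add_sub_cancel_left]
  calc ∑ n ∈ T.filter (fun n => ¬ ∀ i, (n i).Prime), ∏ i, Λ (n i)
      ≤ ∑ n ∈ T.filter (fun n => ¬ ∀ i, (n i).Prime),
          ∑ i : Fin 3, (if ¬ (n i).Prime then ∏ j, Λ (n j) else 0) := by
        refine Finset.sum_le_sum fun n hn => ?_
        obtain ⟨i, hi⟩ := not_forall.mp (Finset.mem_filter.mp hn).2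
        calc ∏ j, Λ (n j) = (if ¬ (n i).Prime then ∏ j, Λ (n j) else 0) := by rw [if_pos hi]
          _ ≤ ∑ i : Fin 3, (if ¬ (n i).Prime then ∏ j, Λ (n j) else 0) :=
            Finset.single_le_sum (f := fun i => if ¬ (n i).Prime then ∏ j, Λ (n j) else 0)
              (fun k _ => hite n k) (Finset.mem_univ i)
    _ ≤ ∑ n ∈ T, ∑ i : Fin 3, (if ¬ (n i).Prime then ∏ j, Λ (n j) else 0) :=
        Finset.sum_le_sum_of_subset_of_nonneg (Finset.filter_subset _ _) fun n _ _ =>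
          Finset.sum_nonneg fun i _ => hite n i
    _ = ∑ i : Fin 3, ∑ n ∈ T.filter (fun n => ¬ (n i).Prime), ∏ j, Λ (n j) := by
        rw [Finset.sum_comm]
        simp only [Finset.sum_filter]
    _ = ∑ i : Fin 3, ∑ n ∈ T.filter (fun n => ¬ (n 0).Prime), ∏ j, Λ (n j) :=
        Finset.sum_congr rfl fun i _ => sum_filter_not_prime_apply_eq N i
    _ ≤ ∑ _i : Fin 3, (ψ N - θ N) * ψ N * Real.log N :=
        Finset.sum_le_sum fun i _ => sum_filter_not_prime_zero_le N
    _ = 3 * ((ψ N - θ N) * ψ N * Real.log N) := by simp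

/-- **From a lower bound for `R₃(N)` to three primes** (the concluding step of Helfgott 2013, §7.4,
and of Vinogradov's theorem, Vaughan Thm. 3.4 ⇒ Corollary): if `R₃(N) > 3 (ψ(N) − ϑ(N)) ψ(N) log N`
then `N` is a sum of three primes. [cite: Helfgott2013TernaryGoldbach, §7.4] -/
theorem exists_three_primes_of_lt_weightedTernaryCount {N : ℕ}
    (h : 3 * ((ψ N - θ N) * ψ N * Real.log N) < weightedTernaryCount N) :
    ∃ p q r : ℕ, p.Prime ∧ q.Prime ∧ r.Prime ∧ p + q + r = N := by
  have hpos : 0 < ∑ n ∈ (Finset.Nat.antidiagonalTuple 3 N).filter (fun n => ∀ i, (n i).Prime),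
      ∏ i, Λ (n i) := by
    have := weightedTernaryCount_sub_sum_filter_prime_le N
    linarith
  obtain ⟨n, hn⟩ := Finset.nonempty_of_sum_ne_zero hpos.ne'
  rw [Finset.mem_filter, Finset.Nat.mem_antidiagonalTuple, Fin.sum_univ_three] at hn
  exact ⟨n 0, n 1, n 2, hn.2 0, hn.2 1, hn.2 2, hn.1⟩

/-- **Explicit form via Chebyshev's bounds** (Mathlib: `ψ(x) − ϑ(x) ≤ 2 √x log x`,
`ψ(x) ≤ (log 4 + 4) x`): if `R₃(N) > 6 (log 4 + 4) N √N (log N)²` then `N` is a sum of three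
primes. Helfgott's §7.4 uses Rosser–Schoenfeld's `1.4262 √N` and `1.03883 N` instead (threshold
`7.3306 N^{3/2} log N` with his smoothing weights). [cite: Helfgott2013TernaryGoldbach, §7.4] -/
theorem exists_three_primes_of_lt_weightedTernaryCount' {N : ℕ}
    (h : 6 * (Real.log 4 + 4) * N * Real.sqrt N * (Real.log N) ^ 2 < weightedTernaryCount N) :
    ∃ p q r : ℕ, p.Prime ∧ q.Prime ∧ r.Prime ∧ p + q + r = N := by
  refine exists_three_primes_of_lt_weightedTernaryCount (lt_of_le_of_lt ?_ h)
  rcases Nat.eq_zero_or_pos N with rfl | hN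
  · simp
  have hN1 : (1 : ℝ) ≤ N := by exact_mod_cast hN
  have h1 : ψ N - θ N ≤ 2 * Real.sqrt N * Real.log N := Chebyshev.psi_sub_theta_le hN1
  have h2 : ψ N ≤ (Real.log 4 + 4) * N := Chebyshev.psi_le_const_mul_self (Nat.cast_nonneg N)
  have h0 : 0 ≤ ψ N - θ N := sub_nonneg.mpr (Chebyshev.theta_le_psi N)
  have hlog : 0 ≤ Real.log N := Real.log_natCast_nonneg N
  calc 3 * ((ψ N - θ N) * ψ N * Real.log N)
      ≤ 3 * ((2 * Real.sqrt N * Real.log N) * ((Real.log 4 + 4) * N) * Real.log N) := by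
        gcongr
    _ = 6 * (Real.log 4 + 4) * N * Real.sqrt N * (Real.log N) ^ 2 := by ring

end PrimePowers

end Literature.NumberTheory.Sieve
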